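import Literature.Algebra.EuclideanLattices.RegevDualQuery
import HarnessLib

/-!
# `det B` clears the denominators of `⟨x, v⟩` for integer `x` and `v ∈ L(B)*`

Topic `Algebra/EuclideanLattices` (family `pqc`); a complement to `RegevDualQuery.lean`
(`LatticeInstance.sum_inner_vec_smul_adjCol`: `∑ᵢ ⟪v, bᵢ⟫·cᵢ = det B · v` with `cᵢ` the integer columns of
`adj B`). PROVED, no definition, no named fact: for `x ∈ ℤⁿ` and `v` in the dual lattice of `L(B)`,
`det B · ⟨x, v⟩ ∈ ℤ` (`exists_int_det_mul_inner_of_mem_dualLattice`). It is the denominator bound that lets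
the machine of Regev's / Peikert's classical `BDD → LWE` reduction (Regev 2009, Lemma 3.11; Peikert 2009,
Prop. 3.2) hold `⟨x, v⟩/q` on the grid `(1/(q·det B))ℤ`, i.e. the hypothesis `hnum` of
`Regev2009.bddLWESampleOf_eq_bind_floorGaussian` (`Computability/Cryptography/RegevBDDIntegerNoise.lean`) with
`N = 2|det B|`.

## References

* D. Micciancio, S. Goldwasser, *Complexity of Lattice Problems*, Kluwer 2002, Ch. 1 §1 (dual basis
  `B⁻ᵀ = (adj B)ᵀ/det B`) [MicciancioGoldwasser2002].
* O. Regev, *On lattices, learning with errors, random linear codes, and cryptography*, J. ACM 56 (2009),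
  Lemma 3.11 (the sample `⟨x, v⟩/p + e`) [RegevLWE2009].
-/

noncomputable section

open scoped InnerProductSpace

namespace Literature.Algebra.EuclideanLattices

namespace LatticeInstance

variable (I : LatticeInstance)

/-- `⟪x, cᵢ⟫ ∈ ℤ` for integer `x` and the integer column `cᵢ` of `adj B`. [folklore] -/
theorem exists_int_inner_intVec_adjCol (x : Fin I.n → ℤ) (i : Fin I.n) :
    ∃ k : ℤ, ⟪intVecToEuclidean I.n x, I.adjCol i⟫_ℝ = k := by
  refine ⟨∑ j, x j * I.basis.adjugate j i, ?_⟩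
  rw [EuclideanSpace.inner_eq_star_dotProduct]
  simp [dotProduct, adjCol_apply, intVecToEuclidean_apply, mul_comm]

/-- **`det B · ⟨x, v⟩ ∈ ℤ` for `x ∈ ℤⁿ` and `v ∈ L(B)*`.** Since `⟪v, bᵢ⟫ ∈ ℤ` for all `i`,
`det B · v = ∑ᵢ ⟪v, bᵢ⟫ cᵢ` is an integer combination of the integer vectors `cᵢ` (`adj B · B = det B · 1`),
so its pairing with the integer vector `x` is an integer. [cite: MicciancioGoldwasser2002, Ch. 1 §1] -/
theorem exists_int_det_mul_inner_of_mem_dualLattice (x : Fin I.n → ℤ) {v : EuclideanSpace ℝ (Fin I.n)}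
    (hv : v ∈ dualLattice I.lattice) :
    ∃ k : ℤ, (I.basis.det : ℝ) * ⟪intVecToEuclidean I.n x, v⟫_ℝ = k := by
  -- integer pairings `wᵢ = ⟪v, bᵢ⟫`
  have hw : ∀ i, ∃ m : ℤ, (m : ℝ) = ⟪v, I.vec i⟫_ℝ := fun i =>
    mem_dualLattice.1 hv _ (Submodule.subset_span (Set.mem_range_self i))
  choose w hw using hw
  choose c hc using fun i => exists_int_inner_intVec_adjCol I x i
  refine ⟨∑ i, w i * c i, ?_⟩
  have hrec := I.sum_inner_vec_smul_adjCol v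
  rw [← real_inner_smul_right, ← hrec, inner_sum]
  push_cast
  refine Finset.sum_congr rfl fun i _ => ?_
  rw [real_inner_smul_right, ← hw i, hc i]

/-- The form consumed by `RegevBDDIntegerNoise`: with `N = 2·|det B|` (even, positive for `B`
nonsingular), `N·⟨x, v⟩ ∈ ℤ` for every `v ∈ L(B)*`. [folklore] -/
theorem exists_int_two_natAbs_det_mul_inner (x : Fin I.n → ℤ) {v : EuclideanSpace ℝ (Fin I.n)}
    (hv : v ∈ dualLattice I.lattice) :
    ∃ k : ℤ, ((2 * I.basis.det.natAbs : ℕ) : ℝ) * ⟪intVecToEuclidean I.n x, v⟫_ℝ = k := by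
  obtain ⟨k, hk⟩ := exists_int_det_mul_inner_of_mem_dualLattice I x hv
  refine ⟨2 * I.basis.det.sign * k, ?_⟩
  have habs : ((I.basis.det.natAbs : ℕ) : ℝ) = (I.basis.det.sign : ℝ) * (I.basis.det : ℝ) := by
    rw [Nat.cast_natAbs, Int.cast_abs]
    rcases lt_trichotomy I.basis.det 0 with h | h | h
    · rw [Int.sign_eq_neg_one_of_neg h, abs_of_neg (by exact_mod_cast h)]; push_cast; ring
    · rw [h]; simp
    · rw [Int.sign_eq_one_of_pos h, abs_of_pos (by exact_mod_cast h)]; push_cast; ring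
  push_cast
  rw [habs, mul_assoc, mul_assoc, hk]
  ring

end LatticeInstance

end Literature.Algebra.EuclideanLattices
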